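import Summits.NavierStokesRegularity.FluidComputer.PalasekTowerStrainShadowedRun
import Summits.NavierStokesRegularity.FluidComputer.PalasekTowerBoxScheduleAt
import Summits.NavierStokesRegularity.FluidComputer.PalasekTowerRegisterGlobalAt
import Summits.NavierStokesRegularity.FluidComputer.PalasekTowerGermHostShadowedRun
import Summits.NavierStokesRegularity.FluidComputer.PalasekTowerBurgersLayerRobust

/-!
# THE STRAIN DOOR AT ARBITRARY RATES `R`: the crux `EpisodeBaseGAt R` from (i) the level-`1` MECHANISM
# DOOR at `R` and (ii) ONE STRAIN CERTIFICATE at `R` — the two registered stub statements of the line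
# `straindoor` of the live crux `EpisodeBaseT = EpisodeBaseGAt TowerRates.tuned` and their composition

Cell `ns-blowup`, seat `ns-palasek-20303-p1` (LEAD prover on stmt-NavierStokesRegularity-20303 `EpisodeBaseT`;
route `PalasekTowerBreakdown`, rev 19). LABEL: E–C typing (KERNEL: two open `Prop`s parametrised by the
rates record — the STATEMENTS of the two stubs of `Cruxes/EpisodeBaseT/Lines/straindoor.lean` — and their
sorry-free composition into `EpisodeBaseGAt R`). WHAT THIS IS NOT: not Navier–Stokes evidence — nothing is
inhabited; no run, design or certificate is exhibited; the two `Prop`s are OPEN at `R = tuned`.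

## The line `straindoor` re-pointed at `R` (cstrat-19179 v2, 1e15dcb638cf; door landed by fc-prover-3 g10)

The strain-currency door is KERNEL and register-free: `StrainShadow.exists_freeRun_near_of_strain`
(p526708; unit viscosity, slab `[0, T]`): next to a classical reference run `(w, ϖ)` FORCED by its
Leray-projected defect `g`, of Tao's `L²`-Sobolev class, with speed `≤ B_w` and continuous COMPRESSION-RATE
majorant `−⟪ξ, Dw(t,x)ξ⟫ ≤ Γ(t)‖ξ‖²`, the free classical finite-energy run from a smooth compactly
supported divergence-free datum `U` EXISTS on the whole slab and stays `δ`-close to `w` in sup norm, provided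
`2 (D + 4h^{1/4}G₂) e^{36C₀²(2B_w+1)²h} ≤ δ` (initial layer, `(24C₀(2B_w+1))²h ≤ 1`) and
`2 ((E₀ + G₂T) e^{∫₀ᵀΓ} + 4G₂h) h^{-3/4} ≤ δ ≤ 1/2` — exponential fee in STRAIN TIMES `e^{∫Γ}`.
What is left of the crux at the rates `R` is therefore exactly two statements:

* `MechanismDoorAt R` — **the level-`1` mechanism door at `R`** (the `R`-generic twin, by substitution
  `wide ↦ R`, `Host.τfirst ↦ Host.τfirstAt R`, of the LANDED wide theorem
  `Theorems.palasekTowerBreakdown_episodeBase_of_mechanism_freeRun`, p523959): ONE classical finite-energy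
  free run on `[1, τfirstAt R]` of a smooth compactly supported divergence-free datum of speed `< Y₀(R)`,
  under the cap `(5/3)Y₁(R) − η`, showing at `τfirstAt R` inside the support radius the speed `Y₁(R) + η`,
  the gradient `A₁(R) + η` and an `N₁(R)`-core loop of circulation `≥ N₁(R)^{β−2} + η` ⟹ `EpisodeBaseGAt R`.
  At `R = wide` it is p523959 verbatim (`Host.τfirstAt_wide : τfirstAt wide = τfirst` is `rfl`); at
  `R = tuned` it is the end `L4` of the `R`-generic door chain of the E–C lineage (ecbridge-3 g8: `L1`
  `PalasekTowerBoxScheduleAt` landed; `L2` `LevelZeroDataAt R`, `L3` tame carrier at `R`, `L4` superposition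
  door at `R` in port) — ONE stub until that chain is accepted, then discharged by name.
* `CertificateAt R` (`CertificateData R …`) — **one strain certificate at `R`**: an explicit datum `U`
  (smooth, divergence free, `tsupport U ⊆ B̄(0,ρ)`, speed `< Y₀(R)`) and a reference run `(w, ϖ, g)` on the
  shifted window clock `[0, wfirstAt R]` carrying EXACTLY the hypotheses of p526708, whose slice at
  `wfirstAt R` is continuous and shows the four EXPLICIT readouts with margins `η + δ`: cap
  `≤ (5/3)Y₁(R) − η − δ` on the window, speed `≥ Y₁(R) + η + δ` at some `‖x‖ ≤ ρ`, finite-difference strain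
  `(A₁(R) + η)‖x₁ − x₀‖ + 2δ < ‖w(x₁) − w(x₀)‖`, core circulation `≥ N₁(R)^{β−2} + η + δ·8π/N₁(R)`.
  This is the mechanism (OPEN; XL: needs a design and a validated computation).

* `faces_of_near` — the currency-free READOUT TRANSFER at `R` (verbatim the wide
  `Germ.LineGermData.freeRun_faces_of_near`, p514213, with `wide ↦ R`): an exact run `δ`-close to a field
  showing the four readouts with margins `η + δ` shows the four faces with margin `η` (mean-value
  inequality `Germ.exists_mem_segment_lt_norm_fderiv` for the strain, `circulation_sub_le_of_near` for the core).
* **`episodeBaseGAt_of_mechanismDoorAt_of_certificateData`** / **`…_of_certificateAt`** — THE COMPOSITION: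
  `MechanismDoorAt R → CertificateAt R → EpisodeBaseGAt R` (the door p526708 on `[0, wfirstAt R]`, the time
  shift `IsClassicalNSSolutionOn.comp_add_right` to `[1, τfirstAt R]`, `faces_of_near`, the mechanism door).

References: S. Palasek, arXiv:2605.13827 §4 [cite: Palasek2026ElementaryModel, §4]; M. Dashti,
J. C. Robinson, SIAM J. Numer. Anal. 46 (2008), Thm. 5 [cite: DashtiRobinson2008, Thm. 5]; J. C. Robinson,
J. L. Rodrigo, W. Sadowski, CUP 2016, Thm. 6.10 / Thm. 9.1 [cite: RobinsonRodrigoSadowski2016, Thm. 9.1];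
T. Tao, Anal. PDE 6 (2013), Thm. 5.4 [cite: Tao2011, Thm. 5.4 (ii)+(iv)].
-/

noncomputable section

namespace Summit.NavierStokesRegularity.FluidComputer.PalasekTowerClayBridge.StrainDoor

open Set MeasureTheory Metric Function InnerProductSpace
open scoped ENNReal NNReal ContDiff RealInnerProductSpace
open Literature.Analysis Literature.Analysis.FluidPDE

/-! ## §1 The two open statements at the rates `R` -/

/-- **The level-`1` MECHANISM DOOR at the rates `R`** (open `Prop`; the `R`-generic twin of the landed wide
theorem `Theorems.palasekTowerBreakdown_episodeBase_of_mechanism_freeRun`, p523959): for every smooth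
divergence-free datum `W` with `tsupport W ⊆ B̄(0, ρ)` (`ρ ≥ 0`) of speed `< Y₀(R)` and every classical
finite-energy FREE run `(v, q)` (`ν = 1`) on `[1, τfirstAt R]` from `v 1 = W` staying below `(5/3)Y₁(R) − η`
(`η > 0`) and showing at `τfirstAt R`, inside `‖x‖ ≤ ρ`, the speed `Y₁(R) + η`, the gradient `A₁(R) + η` and an
`N₁(R)`-core loop (`C¹`, closed, inside `B̄(x, 1/N₁)`, speed `≤ 8π/N₁`) of circulation `≥ N₁(R)^{β−2} + η` —
`EpisodeBaseGAt R`. [cite: Palasek2026ElementaryModel, §4] -/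
def MechanismDoorAt (R : TowerRates) : Prop :=
  ∀ ⦃W : EuclideanSpace ℝ (Fin 3) → EuclideanSpace ℝ (Fin 3)⦄ ⦃ρ : ℝ⦄,
    ContDiff ℝ ∞ W → VectorCalculus.IsDivFree W → tsupport W ⊆ closedBall 0 ρ →
    (∀ x, ‖W x‖ < R.Y 0) → 0 ≤ ρ →
    ∀ ⦃v : ℝ → EuclideanSpace ℝ (Fin 3) → EuclideanSpace ℝ (Fin 3)⦄ ⦃q : ℝ → EuclideanSpace ℝ (Fin 3) → ℝ⦄,
      IsClassicalNSSolutionOn (Icc 1 (Host.τfirstAt R)) 1 0 v q → v 1 = W →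
      (∃ C : ℝ≥0∞, C < ⊤ ∧ ∀ t ∈ Icc (1 : ℝ) (Host.τfirstAt R), ∫⁻ x, ‖v t x‖ₑ ^ 2 ≤ C) →
      ∀ ⦃η : ℝ⦄, 0 < η →
        (∀ t ∈ Icc (1 : ℝ) (Host.τfirstAt R), ∀ x, ‖v t x‖ ≤ 5 / 3 * R.Y 1 - η) →
        (∃ x, ‖x‖ ≤ ρ ∧ R.Y 1 + η ≤ ‖v (Host.τfirstAt R) x‖) →
        (∃ x, ‖x‖ ≤ ρ ∧ R.A 1 + η ≤ ‖fderiv ℝ (v (Host.τfirstAt R)) x‖) →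
        (∃ (x : EuclideanSpace ℝ (Fin 3)) (γ : ℝ → EuclideanSpace ℝ (Fin 3)),
          ‖x‖ ≤ ρ ∧ ContDiff ℝ 1 γ ∧ γ 0 = γ 1 ∧
          (∀ s ∈ Icc (0 : ℝ) 1, γ s ∈ closedBall x (1 / R.N 1)) ∧
          (∀ s ∈ Icc (0 : ℝ) 1, ‖deriv γ s‖ ≤ 8 * Real.pi / R.N 1) ∧
          R.N 1 ^ (R.β - 2) + η ≤ circulation (v (Host.τfirstAt R)) γ) →
        EpisodeBaseGAt R

/-- **The data of ONE STRAIN CERTIFICATE at the rates `R`** (all fields CERTIFICATE-SIDE: static facts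
about an explicit datum `U`, regularity / size facts about an explicit reference run `(w, ϖ)` forced by its
Leray-projected defect `g` on the shifted window clock `[0, wfirstAt R]` — EXACTLY the hypotheses of the
strain-shadowed-run door `StrainShadow.exists_freeRun_near_of_strain` (p526708) — and the four explicit
readouts of the slice `w(wfirstAt R)` with margins `η + δ`). [cite: Palasek2026ElementaryModel, §4]
[cite: DashtiRobinson2008, Thm. 5] -/
structure CertificateData (R : TowerRates)
    (U : EuclideanSpace ℝ (Fin 3) → EuclideanSpace ℝ (Fin 3)) (ρ : ℝ)
    (w g : ℝ → EuclideanSpace ℝ (Fin 3) → EuclideanSpace ℝ (Fin 3)) (ϖ : ℝ → EuclideanSpace ℝ (Fin 3) → ℝ)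
    (Γ : ℝ → ℝ) (Bw Gb G₂ D E₀ h δ η : ℝ) : Prop where
  /-- the datum is smooth … -/
  datum_smooth : ContDiff ℝ ∞ U
  /-- … divergence free … -/
  datum_divFree : VectorCalculus.IsDivFree U
  /-- … supported in the readout ball `B̄(0, ρ)` … -/
  datum_support : tsupport U ⊆ closedBall 0 ρ
  /-- … of speed below the level-`0` scale `Y₀(R)` (the anchor) -/
  datum_lt : ∀ x, ‖U x‖ < R.Y 0
  /-- the readout radius is a genuine radius -/
  radius_nonneg : 0 ≤ ρ
  /-- THE REFERENCE RUN: `(w, ϖ)` is a classical solution at unit viscosity on the shifted window clock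
  `[0, wfirstAt R]`, FORCED BY ITS (Leray-projected) DEFECT `g` -/
  run : IsClassicalNSSolutionOn (Icc 0 (Host.wfirstAt R)) 1 g w ϖ
  /-- the defect is jointly continuous … -/
  defect_cont : Continuous (uncurry g)
  /-- … bounded … -/
  defect_bdd : ∀ τ ∈ Icc 0 (Host.wfirstAt R), ∀ y, ‖g τ y‖ ≤ Gb
  /-- … weakly divergence free (Leray-projected) … -/
  defect_divFree : ∀ τ ∈ Icc 0 (Host.wfirstAt R), IsWeaklyDivFree (g τ)
  /-- … and of `L²` size `≤ G₂`, `G₂ ≥ 0` -/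
  G₂_nonneg : 0 ≤ G₂
  defect_two : ∀ τ ∈ Icc 0 (Host.wfirstAt R), eLpNorm (g τ) 2 volume ≤ ENNReal.ofReal G₂
  /-- finite energy of the reference, uniformly on the window -/
  energy : ∃ C : ℝ≥0∞, C < ⊤ ∧ ∀ t ∈ Icc 0 (Host.wfirstAt R), ∫⁻ x, ‖w t x‖ₑ ^ 2 ≤ C
  /-- Tao's `L²`-Sobolev class: the reference … -/
  sobolev : HasBoundedSobolevNormsOn (Icc 0 (Host.wfirstAt R)) w
  /-- … its time derivative … -/
  sobolev_t : HasBoundedSobolevNormsOn (Icc 0 (Host.wfirstAt R))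
    (FluidPDE.timeDerivWithin (Icc 0 (Host.wfirstAt R)) w)
  /-- … and its pressure -/
  pressure : ∀ n : ℕ, ∃ C' : ℝ≥0, ∀ t ∈ Icc 0 (Host.wfirstAt R),
    ∫⁻ x, ‖iteratedFDeriv ℝ n (ϖ t) x‖ₑ ^ 2 ≤ C'
  /-- the speed bound of the reference, `B_w > 0` -/
  Bw_pos : 0 < Bw
  speed_bdd : ∀ t ∈ Icc 0 (Host.wfirstAt R), ∀ y, ‖w t y‖ ≤ Bw
  /-- THE STRAIN MAJORANT: `Γ ≥ 0` continuous dominates the maximal compression rate of the reference -/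
  Γ_cont : ContinuousOn Γ (Icc 0 (Host.wfirstAt R))
  Γ_nonneg : ∀ t ∈ Icc 0 (Host.wfirstAt R), 0 ≤ Γ t
  strain : ∀ t ∈ Icc 0 (Host.wfirstAt R), ∀ x ξ, -⟪ξ, fderiv ℝ (w t) x ξ⟫ ≤ Γ t * ‖ξ‖ ^ 2
  /-- the datum defect in sup norm … -/
  datum_sup : ∀ y, ‖w 0 y - U y‖ ≤ D
  /-- … and in `L²` (`E₀ ≥ 0`) -/
  E₀_nonneg : 0 ≤ E₀
  datum_two : ∫ x, ‖U x - w 0 x‖ ^ 2 ≤ E₀ ^ 2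
  /-- the terminal smoothing window `h > 0` is SHORT for the sup-norm theory -/
  h_pos : 0 < h
  h_short : (24 * oseenSliceConst (EuclideanSpace ℝ (Fin 3)) * (Bw + 1 + Bw)) ^ 2 * h ≤ 1
  /-- the tolerance: `δ ≤ 1/2`, the initial-layer inequality and the window inequality of p526708 -/
  δ_le : δ ≤ 1 / 2
  δ_layer : 2 * (D + 4 * h ^ (1 / 4 : ℝ) * G₂) *
    Real.exp (36 * oseenSliceConst (EuclideanSpace ℝ (Fin 3)) ^ 2 * (Bw + 1 + Bw) ^ 2 * h) ≤ δ
  δ_window : 2 * ((E₀ + G₂ * Host.wfirstAt R) * Real.exp (∫ s in (0 : ℝ)..Host.wfirstAt R, Γ s) +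
    4 * G₂ * h) * h ^ (-(3 / 4 : ℝ)) ≤ δ
  /-- the margin of the readouts -/
  η_pos : 0 < η
  /-- the readout slice of the reference is continuous -/
  slice_cont : Continuous (w (Host.wfirstAt R))
  /-- READOUT 1 — the cap with margin `η + δ` on the whole window -/
  cap : ∀ t ∈ Icc 0 (Host.wfirstAt R), ∀ x, ‖w t x‖ ≤ 5 / 3 * R.Y 1 - η - δ
  /-- READOUT 2 — the speed floor with margin `η + δ` inside the readout ball -/
  speed : ∃ x, ‖x‖ ≤ ρ ∧ R.Y 1 + η + δ ≤ ‖w (Host.wfirstAt R) x‖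
  /-- READOUT 3 — the strain floor by a finite difference inside the readout ball -/
  strainFD : ∃ x₀ x₁, ‖x₀‖ ≤ ρ ∧ ‖x₁‖ ≤ ρ ∧
    (R.A 1 + η) * ‖x₁ - x₀‖ + 2 * δ < ‖w (Host.wfirstAt R) x₁ - w (Host.wfirstAt R) x₀‖
  /-- READOUT 4 — the core loop with margin `η + δ · 8π/N₁` -/
  core : ∃ (x : EuclideanSpace ℝ (Fin 3)) (γ : ℝ → EuclideanSpace ℝ (Fin 3)),
    ‖x‖ ≤ ρ ∧ ContDiff ℝ 1 γ ∧ γ 0 = γ 1 ∧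
    (∀ s ∈ Icc (0 : ℝ) 1, γ s ∈ closedBall x (1 / R.N 1)) ∧
    (∀ s ∈ Icc (0 : ℝ) 1, ‖deriv γ s‖ ≤ 8 * Real.pi / R.N 1) ∧
    R.N 1 ^ (R.β - 2) + η + δ * (8 * Real.pi / R.N 1) ≤ circulation (w (Host.wfirstAt R)) γ

/-- **ONE STRAIN CERTIFICATE at the rates `R`** (open `Prop`, the mechanism): SOME datum and SOME reference
run with SOME numbers filling `CertificateData R`. [cite: Palasek2026ElementaryModel, §4] -/
def CertificateAt (R : TowerRates) : Prop :=
  ∃ (U : EuclideanSpace ℝ (Fin 3) → EuclideanSpace ℝ (Fin 3)) (ρ : ℝ)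
    (w g : ℝ → EuclideanSpace ℝ (Fin 3) → EuclideanSpace ℝ (Fin 3)) (ϖ : ℝ → EuclideanSpace ℝ (Fin 3) → ℝ)
    (Γ : ℝ → ℝ) (Bw Gb G₂ D E₀ h δ η : ℝ), CertificateData R U ρ w g ϖ Γ Bw Gb G₂ D E₀ h δ η

/-! ## §2 The readout transfer at the rates `R` (currency-free) -/

variable {R : TowerRates}

/-- **READOUT TRANSFER at the rates `R`** (verbatim `Germ.LineGermData.freeRun_faces_of_near` with
`wide ↦ R`): a classical solution `(v, q)` (any force, any viscosity — only the smoothness of the final slice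
is used) on `[1, τfirstAt R]` that is `δ`-close to a field `w` with continuous final slice showing the four
readouts with margins `η + δ` inside `‖x‖ ≤ ρ` shows the four faces with margin `η`: cap, speed, strain
(`‖Dv‖ ≥ A₁(R) + η` somewhere in `B̄(0, ρ)`, by the mean-value inequality) and core.
[cite: Palasek2026ElementaryModel, §4] -/
theorem faces_of_near {ν ρ δ η : ℝ}
    {v w f : ℝ → EuclideanSpace ℝ (Fin 3) → EuclideanSpace ℝ (Fin 3)} {q : ℝ → EuclideanSpace ℝ (Fin 3) → ℝ}
    (hv : IsClassicalNSSolutionOn (Icc 1 (Host.τfirstAt R)) ν f v q)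
    (hnear : ∀ t ∈ Icc (1 : ℝ) (Host.τfirstAt R), ∀ x, ‖v t x - w t x‖ ≤ δ)
    (hwc : Continuous (w (Host.τfirstAt R)))
    (hcap : ∀ t ∈ Icc (1 : ℝ) (Host.τfirstAt R), ∀ x, ‖w t x‖ ≤ 5 / 3 * R.Y 1 - η - δ)
    (hspeed : ∃ x, ‖x‖ ≤ ρ ∧ R.Y 1 + η + δ ≤ ‖w (Host.τfirstAt R) x‖)
    (hstrain : ∃ x₀ x₁, ‖x₀‖ ≤ ρ ∧ ‖x₁‖ ≤ ρ ∧
      (R.A 1 + η) * ‖x₁ - x₀‖ + 2 * δ < ‖w (Host.τfirstAt R) x₁ - w (Host.τfirstAt R) x₀‖)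
    (hcore : ∃ (x : EuclideanSpace ℝ (Fin 3)) (γ : ℝ → EuclideanSpace ℝ (Fin 3)),
      ‖x‖ ≤ ρ ∧ ContDiff ℝ 1 γ ∧ γ 0 = γ 1 ∧
      (∀ s ∈ Icc (0 : ℝ) 1, γ s ∈ closedBall x (1 / R.N 1)) ∧
      (∀ s ∈ Icc (0 : ℝ) 1, ‖deriv γ s‖ ≤ 8 * Real.pi / R.N 1) ∧
      R.N 1 ^ (R.β - 2) + η + δ * (8 * Real.pi / R.N 1) ≤ circulation (w (Host.τfirstAt R)) γ) :
    (∀ t ∈ Icc (1 : ℝ) (Host.τfirstAt R), ∀ x, ‖v t x‖ ≤ 5 / 3 * R.Y 1 - η) ∧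
    (∃ x, ‖x‖ ≤ ρ ∧ R.Y 1 + η ≤ ‖v (Host.τfirstAt R) x‖) ∧
    (∃ x, ‖x‖ ≤ ρ ∧ R.A 1 + η ≤ ‖fderiv ℝ (v (Host.τfirstAt R)) x‖) ∧
    (∃ (x : EuclideanSpace ℝ (Fin 3)) (γ : ℝ → EuclideanSpace ℝ (Fin 3)),
      ‖x‖ ≤ ρ ∧ ContDiff ℝ 1 γ ∧ γ 0 = γ 1 ∧
      (∀ s ∈ Icc (0 : ℝ) 1, γ s ∈ closedBall x (1 / R.N 1)) ∧
      (∀ s ∈ Icc (0 : ℝ) 1, ‖deriv γ s‖ ≤ 8 * Real.pi / R.N 1) ∧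
      R.N 1 ^ (R.β - 2) + η ≤ circulation (v (Host.τfirstAt R)) γ) := by
  have hτmem : Host.τfirstAt R ∈ Icc (1 : ℝ) (Host.τfirstAt R) := ⟨(Host.one_lt_τfirstAt R).le, le_rfl⟩
  set T := Host.τfirstAt R with hT_def
  refine ⟨?_, ?_, ?_, ?_⟩
  · -- the cap
    intro t ht x
    have h1 := hnear t ht x
    have h2 := hcap t ht x
    calc ‖v t x‖ = ‖w t x + (v t x - w t x)‖ := by rw [add_sub_cancel]
      _ ≤ ‖w t x‖ + ‖v t x - w t x‖ := norm_add_le _ _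
      _ ≤ 5 / 3 * R.Y 1 - η := by linarith
  · -- the speed floor
    obtain ⟨x, hx, hfl⟩ := hspeed
    refine ⟨x, hx, ?_⟩
    have h1 := hnear T hτmem x
    have h2 : ‖w T x‖ ≤ ‖v T x‖ + ‖v T x - w T x‖ := by
      calc ‖w T x‖ = ‖v T x - (v T x - w T x)‖ := by rw [sub_sub_cancel]
        _ ≤ ‖v T x‖ + ‖v T x - w T x‖ := norm_sub_le _ _
    have h3 : R.Y 1 + η + δ ≤ ‖w T x‖ := hfl
    linarith
  · -- the strain floor, by the finite difference and the mean-value inequality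
    obtain ⟨x₀, x₁, hx₀, hx₁, hfd⟩ := hstrain
    have h0 := hnear T hτmem x₀
    have h1 := hnear T hτmem x₁
    have hsplit : ‖w T x₁ - w T x₀‖ ≤ ‖v T x₁ - v T x₀‖ + (‖v T x₁ - w T x₁‖ + ‖v T x₀ - w T x₀‖) := by
      have hid : w T x₁ - w T x₀ = (v T x₁ - v T x₀) - ((v T x₁ - w T x₁) - (v T x₀ - w T x₀)) := by
        abel
      rw [hid]
      exact (norm_sub_le _ _).trans (add_le_add le_rfl (norm_sub_le _ _))
    have hlt : (R.A 1 + η) * ‖x₁ - x₀‖ < ‖v T x₁ - v T x₀‖ := by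
      have : (R.A 1 + η) * ‖x₁ - x₀‖ + 2 * δ < ‖w T x₁ - w T x₀‖ := hfd
      linarith
    have hdiff : ∀ x ∈ segment ℝ x₀ x₁, DifferentiableAt ℝ (v T) x := fun x _ =>
      ((hv.contDiff_velocity hτmem).differentiable (by norm_cast)).differentiableAt
    obtain ⟨x, hxseg, hAx⟩ := Germ.exists_mem_segment_lt_norm_fderiv hdiff hlt
    have hxball : x ∈ closedBall (0 : EuclideanSpace ℝ (Fin 3)) ρ :=
      (convex_closedBall (0 : EuclideanSpace ℝ (Fin 3)) ρ).segment_subset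
        (mem_closedBall_zero_iff.2 hx₀) (mem_closedBall_zero_iff.2 hx₁) hxseg
    exact ⟨x, mem_closedBall_zero_iff.1 hxball, hAx.le⟩
  · -- the core loop
    obtain ⟨x, γ, hx, hγ, hγ01, hγball, hγspeed, hcirc⟩ := hcore
    refine ⟨x, γ, hx, hγ, hγ01, hγball, hγspeed, ?_⟩
    have hcv : Continuous (v T) := (hv.contDiff_velocity hτmem).continuous
    have hnear' : ∀ s ∈ Icc (0 : ℝ) 1, ‖v T (γ s) - w T (γ s)‖ ≤ δ := fun s _ => hnear T hτmem (γ s)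
    have h1 := circulation_sub_le_of_near hwc hcv hγ hγspeed hnear'
    linarith

/-! ## §3 The composition: mechanism door + certificate ⟹ `EpisodeBaseGAt R` -/

/-- **THE STRAIN DOOR AT `R`, COMPOSED.** The mechanism door at `R` and the data of one strain certificate at
`R` give `EpisodeBaseGAt R`: the strain-shadowed-run door `StrainShadow.exists_freeRun_near_of_strain`
(p526708) produces the free classical finite-energy run from `U` on the shifted clock `[0, wfirstAt R]`
within `δ` of the reference; shifted to the register clock `[1, τfirstAt R]`
(`IsClassicalNSSolutionOn.comp_add_right`) it shows the four faces with margin `η` (`faces_of_near`), and the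
mechanism door closes. [cite: Palasek2026ElementaryModel, §4] [cite: DashtiRobinson2008, Thm. 5]
[cite: Tao2011, Thm. 5.4 (ii)+(iv)] -/
theorem episodeBaseGAt_of_mechanismDoorAt_of_certificateData (hdoor : MechanismDoorAt R)
    {U : EuclideanSpace ℝ (Fin 3) → EuclideanSpace ℝ (Fin 3)} {ρ : ℝ}
    {w g : ℝ → EuclideanSpace ℝ (Fin 3) → EuclideanSpace ℝ (Fin 3)} {ϖ : ℝ → EuclideanSpace ℝ (Fin 3) → ℝ}
    {Γ : ℝ → ℝ} {Bw Gb G₂ D E₀ h δ η : ℝ} (c : CertificateData R U ρ w g ϖ Γ Bw Gb G₂ D E₀ h δ η) :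
    EpisodeBaseGAt R := by
  set W : ℝ := Host.wfirstAt R with hW_def
  have hW : 0 < W := Host.wfirstAt_pos R
  have hτ : Host.τfirstAt R = 1 + W := Host.τfirstAt_eq R
  -- the datum is a Clay datum
  have hUc : HasCompactSupport U :=
    IsCompact.of_isClosed_subset (isCompact_closedBall (0 : EuclideanSpace ℝ (Fin 3)) ρ)
      (isClosed_tsupport U) c.datum_support
  -- ### the strain-shadowed run on the shifted clock `[0, W]`
  obtain ⟨v', q', hv', hv'0, hv'E, hnear'⟩ :=
    StrainShadow.exists_freeRun_near_of_strain hW c.run c.defect_cont c.defect_bdd c.defect_divFree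
      c.G₂_nonneg c.defect_two c.energy c.sobolev c.sobolev_t c.pressure c.Bw_pos c.speed_bdd c.Γ_cont
      c.Γ_nonneg c.strain c.datum_smooth hUc c.datum_divFree c.datum_sup c.E₀_nonneg c.datum_two c.h_pos
      c.h_short c.δ_le c.δ_layer c.δ_window
  -- ### shift back to the register clock `[1, τfirstAt R]`
  have hmem : ∀ {t : ℝ}, t ∈ Icc (1 : ℝ) (Host.τfirstAt R) → t + -1 ∈ Icc 0 W := fun ht =>
    ⟨by linarith [ht.1], by rw [hτ] at ht; linarith [ht.2]⟩
  have hτ1 : Host.τfirstAt R + -1 = W := by rw [hτ]; ring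
  have hv : IsClassicalNSSolutionOn (Icc 1 (Host.τfirstAt R)) 1 0 (fun t => v' (t + -1))
      (fun t => q' (t + -1)) := by
    have h := (hv'.comp_add_right (-1)).mono (fun t ht => hmem ht)
      (uniqueDiffOn_Icc (by rw [hτ]; linarith))
    have hz : (fun t : ℝ => (0 : ℝ → EuclideanSpace ℝ (Fin 3) → EuclideanSpace ℝ (Fin 3)) (t + -1)) = 0 := by
      funext t; rfl
    rw [hz] at h
    exact h
  have hv1 : (fun t : ℝ => v' (t + -1)) 1 = U := by
    show v' (1 + -1) = U
    norm_num
    exact hv'0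
  have hvE : ∃ C : ℝ≥0∞, C < ⊤ ∧
      ∀ t ∈ Icc (1 : ℝ) (Host.τfirstAt R), ∫⁻ x, ‖(fun t => v' (t + -1)) t x‖ₑ ^ 2 ≤ C := by
    obtain ⟨C, hC, hb⟩ := hv'E
    exact ⟨C, hC, fun t ht => hb (t + -1) (hmem ht)⟩
  have hnear : ∀ t ∈ Icc (1 : ℝ) (Host.τfirstAt R), ∀ x,
      ‖(fun t => v' (t + -1)) t x - (fun t => w (t + -1)) t x‖ ≤ δ := fun t ht x =>
    hnear' (t + -1) (hmem ht) x
  have hwc' : Continuous ((fun t : ℝ => w (t + -1)) (Host.τfirstAt R)) := by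
    show Continuous (w (Host.τfirstAt R + -1))
    rw [hτ1]; exact c.slice_cont
  have hcap' : ∀ t ∈ Icc (1 : ℝ) (Host.τfirstAt R), ∀ x,
      ‖(fun t : ℝ => w (t + -1)) t x‖ ≤ 5 / 3 * R.Y 1 - η - δ := fun t ht x =>
    c.cap (t + -1) (hmem ht) x
  have hspeed' : ∃ x, ‖x‖ ≤ ρ ∧ R.Y 1 + η + δ ≤ ‖(fun t : ℝ => w (t + -1)) (Host.τfirstAt R) x‖ := by
    show ∃ x, ‖x‖ ≤ ρ ∧ R.Y 1 + η + δ ≤ ‖w (Host.τfirstAt R + -1) x‖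
    rw [hτ1]; exact c.speed
  have hstrain' : ∃ x₀ x₁, ‖x₀‖ ≤ ρ ∧ ‖x₁‖ ≤ ρ ∧
      (R.A 1 + η) * ‖x₁ - x₀‖ + 2 * δ <
        ‖(fun t : ℝ => w (t + -1)) (Host.τfirstAt R) x₁ - (fun t : ℝ => w (t + -1)) (Host.τfirstAt R) x₀‖ := by
    show ∃ x₀ x₁, ‖x₀‖ ≤ ρ ∧ ‖x₁‖ ≤ ρ ∧
      (R.A 1 + η) * ‖x₁ - x₀‖ + 2 * δ < ‖w (Host.τfirstAt R + -1) x₁ - w (Host.τfirstAt R + -1) x₀‖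
    rw [hτ1]; exact c.strainFD
  have hcore' : ∃ (x : EuclideanSpace ℝ (Fin 3)) (γ : ℝ → EuclideanSpace ℝ (Fin 3)),
      ‖x‖ ≤ ρ ∧ ContDiff ℝ 1 γ ∧ γ 0 = γ 1 ∧
      (∀ s ∈ Icc (0 : ℝ) 1, γ s ∈ closedBall x (1 / R.N 1)) ∧
      (∀ s ∈ Icc (0 : ℝ) 1, ‖deriv γ s‖ ≤ 8 * Real.pi / R.N 1) ∧
      R.N 1 ^ (R.β - 2) + η + δ * (8 * Real.pi / R.N 1) ≤
        circulation ((fun t : ℝ => w (t + -1)) (Host.τfirstAt R)) γ := by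
    show ∃ (x : EuclideanSpace ℝ (Fin 3)) (γ : ℝ → EuclideanSpace ℝ (Fin 3)),
      ‖x‖ ≤ ρ ∧ ContDiff ℝ 1 γ ∧ γ 0 = γ 1 ∧
      (∀ s ∈ Icc (0 : ℝ) 1, γ s ∈ closedBall x (1 / R.N 1)) ∧
      (∀ s ∈ Icc (0 : ℝ) 1, ‖deriv γ s‖ ≤ 8 * Real.pi / R.N 1) ∧
      R.N 1 ^ (R.β - 2) + η + δ * (8 * Real.pi / R.N 1) ≤ circulation (w (Host.τfirstAt R + -1)) γ
    rw [hτ1]; exact c.core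
  -- ### the four faces of the exact run with margin `η`, then the mechanism door
  obtain ⟨hcapv, hspeedv, hstrainv, hcorev⟩ :=
    faces_of_near (R := R) (ρ := ρ) hv hnear hwc' hcap' hspeed' hstrain' hcore'
  exact hdoor c.datum_smooth c.datum_divFree c.datum_support c.datum_lt c.radius_nonneg hv hv1 hvE
    c.η_pos hcapv hspeedv hstrainv hcorev

/-- **THE STRAIN DOOR AT `R`**: `MechanismDoorAt R → CertificateAt R → EpisodeBaseGAt R` — the shape of the
skeleton `Cruxes/EpisodeBaseT/Lines/straindoor.lean` (`R = TowerRates.tuned`, where `EpisodeBaseGAt tuned` is the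
route's `EpisodeBaseT` by `Iff.rfl`). [cite: Palasek2026ElementaryModel, §4] -/
theorem episodeBaseGAt_of_mechanismDoorAt_of_certificateAt (hdoor : MechanismDoorAt R)
    (hcert : CertificateAt R) : EpisodeBaseGAt R := by
  obtain ⟨U, ρ, w, g, ϖ, Γ, Bw, Gb, G₂, D, E₀, h, δ, η, c⟩ := hcert
  exact episodeBaseGAt_of_mechanismDoorAt_of_certificateData hdoor c

end Summit.NavierStokesRegularity.FluidComputer.PalasekTowerClayBridge.StrainDoor

end
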